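import Literature.Computability.Complexity.CircuitSizeProofs
import Literature.Computability.Complexity.Williams2014
import HarnessLib

/-!
# Murray–Williams 2018, Theorem 3.1 ("almost" an almost-everywhere circuit lower bound for `MA`
# with advice): the hardness analysis, for an abstract paddable, downward self-reducible language

Sixth layer under the named facts `MurrayWilliams2018_NQP_not_ACC`,
`MurrayWilliams2018_NQP_not_subset_ACC0`, `MurrayWilliams2018_NTIME_not_depth_ACC`
(`CircuitLowerBounds.lean`) and their shared bottleneck `MurrayWilliams2018_lemma_4_1_ae`
(`MurrayWilliams2018EasyWitness.lean`, the Easy Witness Lemma for low nondeterministic time,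
Murray–Williams 2018, Lemma 4.1). The printed proof of Lemma 4.1 rests on Theorem 3.1
(C. D. Murray, R. R. Williams, *Circuit lower bounds for nondeterministic quasi-polytime: an easy
witness lemma for NP and NQP*, STOC 2018 / ECCC TR17-188, §3):

> There are `d₁, d₂, d₃ ≥ 1` such that for all circuit-size functions `s` and time-constructible
> `s₁, s₂` with (i) `s₂(n) ≥ s(n)^{2d₂}`, (ii) `s₁(n) ≥ s(s₂(n))`, (iii) `s₁(n) ≥ s(n)^{2d₁+1}`,
> there is a language `L₁` computable by a Merlin–Arthur protocol in `O(s₁(n)² · s₂(n)^{d₃})`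
> time with `2 log s₂(n)` advice such that for all sufficiently large `n`, either the circuit
> complexity of `L₁ⁿ` is greater than `s(n)`, or the circuit complexity of `L₁^{s₂(n)}` is
> greater than `s(s₂(n))`.

Its proof has two halves. The *upper bound* programs the protocol `M₁` with advice
`αₙ := min{s₂(n), ℓ(n)}`, `ℓ(n) :=` the largest `ℓ` such that the complete language `L_PSPACE`
(Santhanam's paddable, downward self-reducible, checkable `PSPACE`-complete language, Thm. 2.2)
has an `s₁(n)`-size circuit on length `ℓ` (displays (1), (2)); on length `n` the protocol
simulates the diagonal language `L_diag` of Thm. 2.3 when `αₙ = s₂(n)` and the padded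
`L_PSPACE` on inputs `1ᵃ0x`, `|x| + 1 ≤ αₙ`, otherwise. The *hardness analysis* (ECCC pp. 10–12:
Proposition 1, Lemma 3.1 with its Amplification Claim, and the concluding paragraph) uses of all
this only:

* `L_diag` has no `s(n)`-size circuits at any large length (Thm. 2.3);
* what `L₁` IS on each length: `L_diagⁿ` if `αₙ = s₂(n)`, and `{1ʲ z : |z| ≤ αₙ, z ∈ L_PSPACE}`
  if `αₙ < s₂(n)` (the padded complete language, read through its paddability
  "`1ᵐ x ∈ L_PSPACE ⟺ x ∈ L_PSPACE`");
* of `αₙ` only that `αₙ ≤ s₂(n)` and that `αₙ ≥ ℓ` whenever `ℓ ≤ s₂(n)` and `L_PSPACE^ℓ` has an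
  `s₁(n)`-size circuit (maximality of `ℓ(n)`);
* the downward self-reduction of `L_PSPACE` in its circuit form: an `s`-size circuit for
  `L_PSPACE^ℓ` yields one of size `(ℓ+1)^{2d₁} · s` for `L_PSPACE^{ℓ+1}` (proof of the
  Amplification Claim: "replace each oracle query with the size-`s(m)` circuit `D_ℓ`");
* the numerical constraints (ii), (iii) and `m ≤ s₂(m)`.

This file PROVES the hardness analysis in exactly that generality — for an arbitrary language
`Lstar` in the role of `L_PSPACE`, an arbitrary `Ldiag`, an arbitrary advice function `α` with
the two properties above, and an arbitrary overhead function `D ℓ s` for the downward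
self-reduction (MW: `D ℓ s = (ℓ+1)^{2d₁} · s`) — so that a formalization of Theorem 3.1 over ANY
complete language with these structural properties (Santhanam's, or another paddable, downward
self-reducible, same-length checkable language) is left with the upper-bound half only: that its
Merlin–Arthur protocol decides, on each length, the language described in the second bullet.
Over the tree's circuits (`Language.circuitSize`: least size of a `B₂`-circuit for the slice,
`CircuitClasses.lean`) hard-wiring inputs to constants costs two gates
(`Circuit.exists_hardwire`, `Williams2014.lean`), so the printed bound "`L_PSPACE^m` has a
circuit of size `s(m)`" of Lemma 3.1 reads `≤ s(m) + 2` here and the constraints carry `+ 2`.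

* `sliceFn_eq_of_forall_iff`, `circuitSize_eq_of_forall_iff` — languages agreeing on `{0,1}ⁿ`
  have the same slice and the same circuit complexity at `n`;
* `circuitSize_preimage_append_le` — **hard-wiring a prefix**: the language `{z : w z ∈ L}` has
  circuit complexity at `ℓ` at most `L.circuitSize (|w| + ℓ) + 2` ("by feeding the string
  `1^{m-ℓ-1}` to the first `m - ℓ - 1` inputs of `C_m`", proof of the Amplification Claim);
* `circuitSize_lstar_le_of_padded` — on a length `m` where `L₁` is the padded `Lstar` up to
  `αₘ`, every slice `Lstar^ℓ`, `ℓ ≤ min αₘ m`, costs at most `L₁.circuitSize m + 2`;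
* `le_alpha_of_amplification` — **Lemma 3.1 / the Amplification Claim**: on such a length,
  if moreover `L₁.circuitSize m + 2 ≤ S₀`, `D ℓ S₀ ≤ s₁(m)` for `ℓ < m` and `m ≤ s₂(m)`, then
  `m ≤ αₘ`
  (induction on `ℓ ≤ m`: small circuits for `Lstar^ℓ` give, by downward self-reducibility,
  `s₁(m)`-size circuits for `Lstar^{ℓ+1}`, whence `ℓ + 1 ≤ αₘ` by maximality), and so
  `Lstar.circuitSize m ≤ L₁.circuitSize m + 2` (`circuitSize_lstar_le_of_amplification`);
* `alpha_lt_of_circuitSize_le` — **Proposition 1**: on a length where `L₁` has an `s(n)`-size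
  circuit but `Ldiag` has none, `αₙ < s₂(n)`;
* bookkeeping the upper-bound half will need, proved here once: `circuitSize_le_of_paddable`
  (paddability `1z ∈ Lstar ⟺ z ∈ Lstar` in circuit form: `Lstar.circuitSize ℓ ≤
  Lstar.circuitSize m + 2` for `ℓ ≤ m`), `circuitSize_zero_le_one`,
  `circuitSize_findGreatest_le` (the advice guarantees that the guessed circuits exist), and
  `replicate_append_mem_iff_of_branch` — the language decided by the protocol's second branch,
  `{1ᵃ0x : |x| + 1 ≤ αₙ, 1^{αₙ-|x|-1}0x ∈ Lstar}`, IS the interface `hL1b` below, given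
  paddability and that no all-ones word lies in `Lstar` (`exists_eq_replicate_append`: the parse
  `y = 1ᵃ0x`);
* **`eventually_lt_circuitSize_or`** — **Theorem 3.1, hardness half**: for all sufficiently
  large `n`, `s(n) < L₁.circuitSize n` or `s(s₂(n)) < L₁.circuitSize (s₂(n))`;
* `eventually_lt_circuitSize_or_findGreatest` — the same with MW's advice
  `αₙ = the largest ℓ ≤ s₂(n) with Lstar.circuitSize ℓ ≤ s₁(n)` (`Nat.findGreatest`; this is
  `min{s₂(n), ℓ(n)}` of display (2)).

Everything is proved; no definition, no machine, no named fact is introduced. `lean search`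
(2026-08-15): no prior formalization of any part of Thm. 3.1 in the tree (the review section of
`MurrayWilliams2018EasyWitness.lean` lists Thm. 3.1 among the absent ingredients of Lemma 4.1).

## References

* C. D. Murray, R. R. Williams, *Circuit lower bounds for nondeterministic quasi-polytime: an easy
  witness lemma for NP and NQP*, STOC 2018 (ECCC TR17-188), §3: Thm. 3.1, displays (1)–(3),
  Proposition 1, Lemma 3.1 and the Amplification Claim (ECCC pp. 9–12) [MurrayWilliams2018].
* R. Santhanam, *Circuit lower bounds for Merlin–Arthur classes*, SIAM J. Comput. 39 (2009)
  1038–1061, Thm. 1.3 and Lemma 2.x (the argument this theorem refines).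
* R. Williams, *Nonuniform ACC circuit lower bounds*, J. ACM 61 (2014), proof of Lemma 5.1
  (hard-wiring inputs) [Williams2014].
-/

namespace Literature.Computability.Complexity

open Filter

namespace AlmostAE

/-! ### Slices and circuit complexity of languages agreeing on a length -/

/-- Languages that agree on all words of length `n` have the same `n`-th slice. [folklore] -/
theorem sliceFn_eq_of_forall_iff {L L' : Language Bool} {n : ℕ}
    (h : ∀ y : List Bool, y.length = n → (y ∈ L ↔ y ∈ L')) : L.sliceFn n = L'.sliceFn n := by
  funext x
  have hx : (List.ofFn x).length = n := List.length_ofFn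
  unfold Language.sliceFn
  by_cases hm : List.ofFn x ∈ L
  · rw [(Set.mem_iff_boolIndicator _ _).1 hm, (Set.mem_iff_boolIndicator _ _).1 ((h _ hx).1 hm)]
  · rw [(Set.notMem_iff_boolIndicator _ _).1 hm,
      (Set.notMem_iff_boolIndicator _ _).1 fun h' => hm ((h _ hx).2 h')]

/-- Languages that agree on all words of length `n` have the same circuit complexity at `n`.
[folklore] -/
theorem circuitSize_eq_of_forall_iff {L L' : Language Bool} {n : ℕ}
    (h : ∀ y : List Bool, y.length = n → (y ∈ L ↔ y ∈ L')) :
    L.circuitSize n = L'.circuitSize n := by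
  unfold Language.circuitSize
  rw [sliceFn_eq_of_forall_iff h]

/-! ### Hard-wiring a prefix -/

/-- **Hard-wiring a prefix.** For every word `w`, the language `{z : w z ∈ L}` has circuit
complexity at length `ℓ` at most `L.circuitSize (|w| + ℓ) + 2`: take an optimal `B₂`-circuit for
the slice of `L` at `|w| + ℓ` and feed the constants `w` to its first `|w|` inputs
(`Circuit.exists_hardwire`: two extra constant gates). Murray–Williams, proof of the Amplification
Claim: "by feeding the string `1^{m-ℓ-1}` to the first `m - ℓ - 1` inputs of `C_m`, the remaining
subcircuit … can compute `L^{ℓ+1}_PSPACE`". [cite: MurrayWilliams2018, Lemma 3.1 (proof)] -/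
theorem circuitSize_preimage_append_le (L : Language Bool) (w : List Bool) (ℓ : ℕ) :
    Language.circuitSize ((fun z => w ++ z) ⁻¹' L) ℓ ≤ L.circuitSize (w.length + ℓ) + 2 := by
  obtain ⟨C, hCB, hCf, hCs⟩ := exists_circuit_size_eq_circuitSize L (w.length + ℓ)
  let σ : Fin (w.length + ℓ) → Fin ℓ ⊕ Bool := fun j =>
    if h : (j : ℕ) < w.length then Sum.inr (w[(j : ℕ)]'h) else Sum.inl ⟨j - w.length, by omega⟩
  -- the constants `0 = ∨₀`, `1 = ∧₀` are `B₂` gates (arity `0 ≤ 2`)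
  obtain ⟨D, hD, hsize, -, heval⟩ :=
    Circuit.exists_hardwire (show (0 : ℕ) ≤ 2 by omega) (show (0 : ℕ) ≤ 2 by omega) C hCB σ
  have hcomp : D.Computes (Language.sliceFn ((fun z => w ++ z) ⁻¹' L) ℓ) := by
    intro x
    rw [heval, hCf]
    have hlist : List.ofFn (fun j => Sum.elim x id (σ j)) = w ++ List.ofFn x := by
      apply List.ext_getElem
      · simp
      · intro i h₁ h₂
        rw [List.getElem_ofFn]
        by_cases hi : i < w.length
        · simp only [σ, dif_pos hi, Sum.elim_inr, id]
          rw [List.getElem_append_left hi]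
        · have hi' : i - w.length < ℓ := by
            rw [List.length_ofFn] at h₁
            omega
          simp only [σ, dif_neg hi, Sum.elim_inl]
          rw [List.getElem_append_right (Nat.le_of_not_lt hi), List.getElem_ofFn]
    show L.boolIndicator (List.ofFn fun j => Sum.elim x id (σ j)) =
      Set.boolIndicator ((fun z => w ++ z) ⁻¹' L) (List.ofFn x)
    rw [hlist]
    rfl
  calc Language.circuitSize ((fun z => w ++ z) ⁻¹' L) ℓ ≤ D.size :=
        circuitSizeOver_le_of_computes D hD hcomp
    _ ≤ C.size + 2 := hsize
    _ = L.circuitSize (w.length + ℓ) + 2 := by rw [hCs]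

/-! ### Lemma 3.1 and the Amplification Claim -/

/-- **Small slices of `Lstar` from a circuit for `L₁` on a padded length.** If on length `m` the
language `L₁` is the padded `Lstar` up to `a` — `1ʲ z ∈ L₁ ⟺ z ∈ Lstar` for `j + |z| = m`,
`|z| ≤ a` (the case `αₘ < s₂(m)` of the protocol `M₁`, read through the paddability of
`L_PSPACE`) — then for every `ℓ ≤ min a m` the slice `Lstar^ℓ` has circuit complexity at most
`L₁.circuitSize m + 2` (hard-wire `1^{m-ℓ}`). [cite: MurrayWilliams2018, Lemma 3.1 (proof)] -/
theorem circuitSize_lstar_le_of_padded {Lstar L₁ : Language Bool} {m a : ℕ}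
    (hL1b : ∀ (j : ℕ) (z : List Bool), j + z.length = m → z.length ≤ a →
      (List.replicate j true ++ z ∈ L₁ ↔ z ∈ Lstar))
    {ℓ : ℕ} (hℓa : ℓ ≤ a) (hℓm : ℓ ≤ m) :
    Lstar.circuitSize ℓ ≤ L₁.circuitSize m + 2 := by
  have heq : Lstar.circuitSize ℓ =
      Language.circuitSize ((fun z => List.replicate (m - ℓ) true ++ z) ⁻¹' L₁) ℓ :=
    circuitSize_eq_of_forall_iff fun y hy =>
      (hL1b (m - ℓ) y (by omega) (hy ▸ hℓa)).symm
  rw [heq]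
  have h := circuitSize_preimage_append_le L₁ (List.replicate (m - ℓ) true) ℓ
  rwa [List.length_replicate, Nat.sub_add_cancel hℓm] at h

/-- **Lemma 3.1 / the Amplification Claim** (Murray–Williams 2018, proof of Thm. 3.1), abstract
form. On a length `m` where `L₁` is the padded `Lstar` up to the advice value `αₘ` and has
circuit complexity `L₁.circuitSize m ≤ S₀ - 2`: if the downward self-reduction of `Lstar` turns
a bound `S` on `Lstar.circuitSize ℓ` into the bound `D ℓ S` on `Lstar.circuitSize (ℓ + 1)`, if
`D ℓ S₀ ≤ s₁(m)` for all `ℓ < m` (constraint (iii), `S₀ = s(m) + 2`), if `m ≤ s₂(m)`, and if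
`αₘ ≥ ℓ`
for every `ℓ ≤ s₂(m)` at which `Lstar` has an `s₁(m)`-size circuit (maximality of `ℓ(m)`,
displays (1)–(2)), then `m ≤ αₘ`. Printed induction: "if there is an `ℓ < m` such that
`L^ℓ_PSPACE` has a size-`s(m)` circuit, then `L^{ℓ+1}_PSPACE` also has a size-`s(m)` circuit" —
here run on the statement `ℓ ≤ αₘ`: from `ℓ ≤ αₘ` the slice `Lstar^ℓ` costs `≤ S₀`
(`circuitSize_lstar_le_of_padded`), so `Lstar^{ℓ+1}` costs `≤ D ℓ S₀ ≤ s₁(m)`, so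
`ℓ + 1 ≤ αₘ`. [cite: MurrayWilliams2018, Lemma 3.1] -/
theorem le_alpha_of_amplification {Lstar L₁ : Language Bool} {D : ℕ → ℕ → ℕ}
    {m αm s₁m s₂m S₀ : ℕ}
    (hdsr : ∀ ℓ S : ℕ, Lstar.circuitSize ℓ ≤ S → Lstar.circuitSize (ℓ + 1) ≤ D ℓ S)
    (hS₀ : L₁.circuitSize m + 2 ≤ S₀)
    (hiii : ∀ ℓ < m, D ℓ S₀ ≤ s₁m)
    (hm : m ≤ s₂m)
    (hα_max : ∀ ℓ, ℓ ≤ s₂m → Lstar.circuitSize ℓ ≤ s₁m → ℓ ≤ αm)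
    (hL1b : ∀ (j : ℕ) (z : List Bool), j + z.length = m → z.length ≤ αm →
      (List.replicate j true ++ z ∈ L₁ ↔ z ∈ Lstar)) :
    m ≤ αm := by
  suffices H : ∀ ℓ, ℓ ≤ m → ℓ ≤ αm from H m le_rfl
  intro ℓ
  induction ℓ with
  | zero => exact fun _ => Nat.zero_le _
  | succ ℓ ih =>
    intro hℓm
    have hℓα : ℓ ≤ αm := ih (Nat.le_of_succ_le hℓm)
    have h1 : Lstar.circuitSize ℓ ≤ S₀ :=
      (circuitSize_lstar_le_of_padded hL1b hℓα (Nat.le_of_succ_le hℓm)).trans hS₀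
    have h2 : Lstar.circuitSize (ℓ + 1) ≤ s₁m :=
      (hdsr ℓ _ h1).trans (hiii ℓ (Nat.lt_of_succ_le hℓm))
    exact hα_max (ℓ + 1) (hℓm.trans hm) h2

/-- **Conclusion of Lemma 3.1**: under the hypotheses of `le_alpha_of_amplification`, the slice
`Lstar^m` itself has circuit complexity at most `L₁.circuitSize m + 2` ("we conclude that
`L^m_PSPACE` has a circuit of size `s(m)`"; `+ 2` for the tree's hard-wiring).
[cite: MurrayWilliams2018, Lemma 3.1] -/
theorem circuitSize_lstar_le_of_amplification {Lstar L₁ : Language Bool} {D : ℕ → ℕ → ℕ}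
    {m αm s₁m s₂m S₀ : ℕ}
    (hdsr : ∀ ℓ S : ℕ, Lstar.circuitSize ℓ ≤ S → Lstar.circuitSize (ℓ + 1) ≤ D ℓ S)
    (hS₀ : L₁.circuitSize m + 2 ≤ S₀)
    (hiii : ∀ ℓ < m, D ℓ S₀ ≤ s₁m)
    (hm : m ≤ s₂m)
    (hα_max : ∀ ℓ, ℓ ≤ s₂m → Lstar.circuitSize ℓ ≤ s₁m → ℓ ≤ αm)
    (hL1b : ∀ (j : ℕ) (z : List Bool), j + z.length = m → z.length ≤ αm →
      (List.replicate j true ++ z ∈ L₁ ↔ z ∈ Lstar)) :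
    Lstar.circuitSize m ≤ L₁.circuitSize m + 2 :=
  circuitSize_lstar_le_of_padded hL1b (le_alpha_of_amplification hdsr hS₀ hiii hm hα_max hL1b)
    le_rfl

/-! ### Proposition 1 -/

/-- **Proposition 1** (Murray–Williams 2018, proof of Thm. 3.1): on a length `n` where `Ldiag`
has no `s(n)`-size circuit, if `L₁ⁿ` has an `s(n)`-size circuit then `L₁` is not simulating
`Ldiag` on length `n`, i.e. `αₙ < s₂(n)` ("Then `αₘ = s₂(m)` for those `m`, and by the
definition of `L₁`, `L₁^m = L^m_diag` … a contradiction to Theorem 2.3").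
[cite: MurrayWilliams2018, Thm. 3.1 (proof, Proposition 1)] -/
theorem alpha_lt_of_circuitSize_le {Ldiag L₁ : Language Bool} {n αn s₂n sn : ℕ}
    (hα_le : αn ≤ s₂n)
    (hL1a : αn = s₂n → ∀ y : List Bool, y.length = n → (y ∈ L₁ ↔ y ∈ Ldiag))
    (hdiag : sn < Ldiag.circuitSize n) (hsmall : L₁.circuitSize n ≤ sn) :
    αn < s₂n := by
  refine lt_of_le_of_ne hα_le fun heq => ?_
  have h : L₁.circuitSize n = Ldiag.circuitSize n := circuitSize_eq_of_forall_iff (hL1a heq)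
  omega


/-! ### What the protocol must supply: paddability bookkeeping -/

/-- **Paddability, circuit form** ("since `L_PSPACE` is paddable, a circuit for `L^m_PSPACE` can
solve `L^ℓ_PSPACE` for any `ℓ < m` by setting the first `m - ℓ` bits to `1`"): if
`1 z ∈ Lstar ⟺ z ∈ Lstar` then `Lstar.circuitSize ℓ ≤ Lstar.circuitSize m + 2` for `ℓ ≤ m`
(`+ 2` for the hard-wired constants). [cite: MurrayWilliams2018, Thm. 3.1 (proof)] -/
theorem circuitSize_le_of_paddable {Lstar : Language Bool}
    (hpad : ∀ z : List Bool, true :: z ∈ Lstar ↔ z ∈ Lstar) {ℓ m : ℕ} (hℓm : ℓ ≤ m) :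
    Lstar.circuitSize ℓ ≤ Lstar.circuitSize m + 2 := by
  have hiter : ∀ (j : ℕ) (z : List Bool), List.replicate j true ++ z ∈ Lstar ↔ z ∈ Lstar := by
    intro j z
    induction j with
    | zero => simp
    | succ j ih => rw [List.replicate_succ, List.cons_append, hpad, ih]
  have heq : Lstar.circuitSize ℓ =
      Language.circuitSize ((fun z => List.replicate (m - ℓ) true ++ z) ⁻¹' Lstar) ℓ :=
    circuitSize_eq_of_forall_iff fun y _ => (hiter (m - ℓ) y).symm
  rw [heq]
  have h := circuitSize_preimage_append_le Lstar (List.replicate (m - ℓ) true) ℓ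
  rwa [List.length_replicate, Nat.sub_add_cancel hℓm] at h

/-- The slice at length `0` costs at most one gate (a constant). [folklore] -/
theorem circuitSize_zero_le_one (L : Language Bool) : L.circuitSize 0 ≤ 1 := by
  have hB : (Circuit.const (Fin 0) (L.sliceFn 0 Fin.elim0)).IsOver B2 := by
    intro g hg
    simp only [Circuit.const, List.mem_singleton] at hg
    subst hg
    change (0 : ℕ) ≤ 2
    omega
  have h : (Circuit.const (Fin 0) (L.sliceFn 0 Fin.elim0)).Computes (L.sliceFn 0) := by
    intro x
    rw [Circuit.eval_const, Subsingleton.elim x Fin.elim0]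
  unfold Language.circuitSize
  exact (circuitSizeOver_le_of_computes _ hB h).trans (by simp)

/-- **The advice guarantees the guessed circuits exist** ("`αₙ` ensures that the desired
circuits `C` being guessed always exist in both branches of `M₁`"): with
`αₙ = the largest ℓ ≤ s₂(n) with Lstar.circuitSize ℓ ≤ s₁(n)` and `s₁(n) ≥ 1`, the slice
`Lstar^{αₙ}` has a `B₂`-circuit of size at most `s₁(n)` (the length-`0` slice always qualifies).
[cite: MurrayWilliams2018, Thm. 3.1 (proof)] -/
theorem circuitSize_findGreatest_le {Lstar : Language Bool} {s₁n : ℕ} (h1 : 1 ≤ s₁n) (N : ℕ) :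
    Lstar.circuitSize (Nat.findGreatest (fun ℓ => Lstar.circuitSize ℓ ≤ s₁n) N) ≤ s₁n :=
  Nat.findGreatest_spec (P := fun ℓ => Lstar.circuitSize ℓ ≤ s₁n) (Nat.zero_le N)
    ((circuitSize_zero_le_one Lstar).trans h1)

/-- A word over `{0,1}` is a block of ones followed by nothing or by a word starting with `0`.
[folklore] -/
theorem exists_eq_replicate_append (z : List Bool) :
    ∃ b : ℕ, z = List.replicate b true ∨ ∃ x : List Bool, z = List.replicate b true ++ false :: x := by
  induction z with
  | nil => exact ⟨0, Or.inl rfl⟩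
  | cons a z ih =>
    cases a with
    | false => exact ⟨0, Or.inr ⟨z, rfl⟩⟩
    | true =>
      obtain ⟨b, h | ⟨x, h⟩⟩ := ih
      · exact ⟨b + 1, Or.inl (by rw [h]; rfl)⟩
      · exact ⟨b + 1, Or.inr ⟨x, by rw [h]; rfl⟩⟩

/-- **From the protocol's second branch to `hL1b`.** Murray–Williams' `M₁` on a length `n` with
`αₙ < s₂(n)`: "Parse `y = 1ᵃ0x`. If `|x| + 1 > αₙ` then reject. Guess an `αₙ`-input circuit …
Output `M^C(1^{αₙ-|x|-1}0x)`", so that (by the checkability of `L_PSPACE`, under the promise) the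
language decided on length `n` is `{1ᵃ0x : |x| + 1 ≤ αₙ, 1^{αₙ-|x|-1}0x ∈ L_PSPACE}` (`hM`). With the
paddability `1z ∈ Lstar ⟺ z ∈ Lstar` and no all-ones word in `Lstar` (for `L_PSPACE = {1ᵐ0x}`
both hold by definition) this is the interface `hL1b` of `eventually_lt_circuitSize_or`:
`1ʲ z ∈ L₁ ⟺ z ∈ Lstar` whenever `j + |z| = n` and `|z| ≤ αₙ`.
[cite: MurrayWilliams2018, Thm. 3.1 (proof)] -/
theorem replicate_append_mem_iff_of_branch {Lstar L₁ : Language Bool} {n αn : ℕ}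
    (hpad : ∀ z : List Bool, true :: z ∈ Lstar ↔ z ∈ Lstar)
    (hones : ∀ b : ℕ, List.replicate b true ∉ Lstar)
    (hM : ∀ y : List Bool, y.length = n →
      (y ∈ L₁ ↔ ∃ (a : ℕ) (x : List Bool), y = List.replicate a true ++ false :: x ∧
        x.length + 1 ≤ αn ∧ List.replicate (αn - (x.length + 1)) true ++ false :: x ∈ Lstar))
    (j : ℕ) (z : List Bool) (hjz : j + z.length = n) (hz : z.length ≤ αn) :
    List.replicate j true ++ z ∈ L₁ ↔ z ∈ Lstar := by
  have hiter : ∀ (b : ℕ) (w : List Bool), List.replicate b true ++ w ∈ Lstar ↔ w ∈ Lstar := by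
    intro b w
    induction b with
    | zero => simp
    | succ b ih => rw [List.replicate_succ, List.cons_append, hpad, ih]
  have hlen : (List.replicate j true ++ z).length = n := by simpa using hjz
  obtain ⟨b, hb | ⟨x, hb⟩⟩ := exists_eq_replicate_append z
  · -- `z = 1ᵇ`: `1ʲ z = 1ⁿ` is rejected, and `1ᵇ ∉ Lstar`
    constructor
    · intro hmem
      obtain ⟨a, x, heq, -, -⟩ := (hM _ hlen).1 hmem
      have hmem' : false ∈ List.replicate j true ++ z := by
        rw [heq]; simp
      rw [hb, ← List.replicate_add] at hmem'
      simp at hmem'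
    · intro hmem
      exact (hones b (hb ▸ hmem)).elim
  · -- `z = 1ᵇ 0 x`
    have hlen' : (List.replicate (j + b) true ++ false :: x).length = n := by
      simp only [List.length_append, List.length_replicate, List.length_cons]
      rw [hb] at hjz
      simp only [List.length_append, List.length_replicate, List.length_cons] at hjz
      omega
    have hxz : x.length + 1 ≤ αn := by
      have : x.length + 1 ≤ z.length := by rw [hb]; simp
      exact this.trans hz
    rw [hb, hiter, ← List.append_assoc, ← List.replicate_add, hM _ hlen']
    -- the parse `y = 1ᵃ0x` is unique
    have hinj : ∀ (a a' : ℕ) (x' : List Bool),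
        List.replicate a true ++ false :: x = List.replicate a' true ++ false :: x' → x = x' := by
      intro a
      induction a with
      | zero =>
        intro a' x' h
        cases a' with
        | zero => simpa using h
        | succ a' => simp [List.replicate_succ] at h
      | succ a ih =>
        intro a' x' h
        cases a' with
        | zero => simp [List.replicate_succ] at h
        | succ a' =>
          simp only [List.replicate_succ, List.cons_append, List.cons.injEq, true_and] at h
          exact ih a' x' h
    constructor
    · rintro ⟨a, x', heq, -, hmem⟩
      rw [hinj _ _ _ heq]
      exact (hiter _ _).1 hmem
    · intro hmem
      exact ⟨j + b, x, rfl, hxz, (hiter _ _).2 hmem⟩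

/-! ### Theorem 3.1, hardness half -/

/-- **Murray–Williams 2018, Theorem 3.1 — the "almost" almost-everywhere hardness of `L₁`,
for an abstract complete language.** Data: size functions `s s₁ s₂`, an advice function `α`,
a downward-self-reduction overhead `D`, languages `Lstar` (the paddable, downward self-reducible
complete language; `L_PSPACE` in print), `Ldiag` (the diagonal language of Thm. 2.3) and `L₁`
(the language of the Merlin–Arthur protocol `M₁`). Hypotheses, each for all sufficiently large
`n` where printed so: `n ≤ s₂(n)`; constraint (ii) `s(s₂(n)) + 2 ≤ s₁(n)`; constraint (iii) in
the form `D ℓ (s(m) + 2) ≤ s₁(m)` for `ℓ < m` (MW: `(ℓ+1)^{2d₁} · s(m) ≤ s(m)^{2d₁+1} ≤ s₁(m)`);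
the circuit form of the downward self-reduction of `Lstar` (`hdsr`); `αₙ ≤ s₂(n)` and the
maximality `ℓ ≤ s₂(n) → Lstar.circuitSize ℓ ≤ s₁(n) → ℓ ≤ αₙ` (displays (1)–(2)); Thm. 2.3 for
`Ldiag` (`hdiag`); and the description of `L₁` on each large length — `L₁ⁿ = Ldiagⁿ` if
`αₙ = s₂(n)` (`hL1a`), `1ʲ z ∈ L₁ ⟺ z ∈ Lstar` for `j + |z| = n`, `|z| ≤ αₙ` if `αₙ < s₂(n)`
(`hL1b`; the branch "simulate `L_PSPACE` on a padded input" together with the paddability of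
`L_PSPACE`). Conclusion: for all sufficiently large `n`, `s(n) < L₁.circuitSize n` or
`s(s₂(n)) < L₁.circuitSize (s₂(n))`. Printed proof: were both small at a large `n`,
Proposition 1 gives `αₙ < s₂(n)` and `α_{s₂(n)} < s₂(s₂(n))`; Lemma 3.1 at `m = s₂(n)` gives
`Lstar.circuitSize (s₂ n) ≤ s(s₂ n) + 2 ≤ s₁(n)` by (ii), whence `αₙ ≥ s₂(n)` by maximality —
"which contradicts (3)". [cite: MurrayWilliams2018, Thm. 3.1] -/
theorem eventually_lt_circuitSize_or
    {s s₁ s₂ α : ℕ → ℕ} {D : ℕ → ℕ → ℕ} {Lstar Ldiag L₁ : Language Bool}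
    (hs₂ : ∀ᶠ n in atTop, n ≤ s₂ n)
    (hii : ∀ᶠ n in atTop, s (s₂ n) + 2 ≤ s₁ n)
    (hiii : ∀ᶠ m in atTop, ∀ ℓ < m, D ℓ (s m + 2) ≤ s₁ m)
    (hdsr : ∀ ℓ S : ℕ, Lstar.circuitSize ℓ ≤ S → Lstar.circuitSize (ℓ + 1) ≤ D ℓ S)
    (hα_le : ∀ n, α n ≤ s₂ n)
    (hα_max : ∀ n ℓ, ℓ ≤ s₂ n → Lstar.circuitSize ℓ ≤ s₁ n → ℓ ≤ α n)
    (hdiag : ∀ᶠ n in atTop, s n < Ldiag.circuitSize n)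
    (hL1a : ∀ᶠ n in atTop, α n = s₂ n → ∀ y : List Bool, y.length = n → (y ∈ L₁ ↔ y ∈ Ldiag))
    (hL1b : ∀ᶠ n in atTop, α n < s₂ n → ∀ (j : ℕ) (z : List Bool), j + z.length = n →
      z.length ≤ α n → (List.replicate j true ++ z ∈ L₁ ↔ z ∈ Lstar)) :
    ∀ᶠ n in atTop, s n < L₁.circuitSize n ∨ s (s₂ n) < L₁.circuitSize (s₂ n) := by
  have hall := ((((hs₂.and hii).and hiii).and hdiag).and hL1a).and hL1b
  obtain ⟨N, hN⟩ := eventually_atTop.1 hall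
  refine eventually_atTop.2 ⟨N, fun n hn => ?_⟩
  by_contra hcon
  rw [not_or, not_lt, not_lt] at hcon
  obtain ⟨hA, hB⟩ := hcon
  -- the hypotheses at `n` and at `m := s₂ n ≥ n`
  obtain ⟨⟨⟨⟨⟨hs₂n, hiin⟩, -⟩, hdiagn⟩, hL1an⟩, -⟩ := hN n hn
  have hmN : N ≤ s₂ n := hn.trans hs₂n
  obtain ⟨⟨⟨⟨⟨hs₂m, -⟩, hiiim⟩, hdiagm⟩, hL1am⟩, hL1bm⟩ := hN (s₂ n) hmN
  -- Proposition 1 at `n` and at `s₂ n`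
  have hαn : α n < s₂ n := alpha_lt_of_circuitSize_le (hα_le n) hL1an hdiagn hA
  have hαm : α (s₂ n) < s₂ (s₂ n) :=
    alpha_lt_of_circuitSize_le (hα_le (s₂ n)) hL1am hdiagm hB
  -- Lemma 3.1 at `m = s₂ n`, with `S₀ = s (s₂ n) + 2`
  have hstar : Lstar.circuitSize (s₂ n) ≤ s₁ n :=
    calc Lstar.circuitSize (s₂ n) ≤ L₁.circuitSize (s₂ n) + 2 :=
          circuitSize_lstar_le_of_amplification hdsr (Nat.add_le_add_right hB 2) hiiim hs₂m
            (hα_max (s₂ n)) (hL1bm hαm)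
      _ ≤ s (s₂ n) + 2 := Nat.add_le_add_right hB 2
      _ ≤ s₁ n := hiin
  -- maximality of `ℓ(n)`: `αₙ ≥ s₂ n`, contradicting Proposition 1 at `n`
  exact absurd (hα_max n (s₂ n) le_rfl hstar) (not_le.2 hαn)

/-- **Theorem 3.1, hardness half, with Murray–Williams' advice.** The same with the advice
function of displays (1)–(2): `αₙ :=` the largest `ℓ ≤ s₂(n)` such that `Lstar^ℓ` has a
`B₂`-circuit of size at most `s₁(n)` (`Nat.findGreatest`; printed as `min{s₂(n), ℓ(n)}` with
`ℓ(n)` the largest such `ℓ` overall), which satisfies `αₙ ≤ s₂(n)` and the maximality property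
by `Nat.findGreatest_le`, `Nat.le_findGreatest`. [cite: MurrayWilliams2018, Thm. 3.1] -/
theorem eventually_lt_circuitSize_or_findGreatest
    {s s₁ s₂ : ℕ → ℕ} {D : ℕ → ℕ → ℕ} {Lstar Ldiag L₁ : Language Bool}
    (hs₂ : ∀ᶠ n in atTop, n ≤ s₂ n)
    (hii : ∀ᶠ n in atTop, s (s₂ n) + 2 ≤ s₁ n)
    (hiii : ∀ᶠ m in atTop, ∀ ℓ < m, D ℓ (s m + 2) ≤ s₁ m)
    (hdsr : ∀ ℓ S : ℕ, Lstar.circuitSize ℓ ≤ S → Lstar.circuitSize (ℓ + 1) ≤ D ℓ S)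
    (hdiag : ∀ᶠ n in atTop, s n < Ldiag.circuitSize n)
    (hL1a : ∀ᶠ n in atTop,
      Nat.findGreatest (fun ℓ => Lstar.circuitSize ℓ ≤ s₁ n) (s₂ n) = s₂ n →
        ∀ y : List Bool, y.length = n → (y ∈ L₁ ↔ y ∈ Ldiag))
    (hL1b : ∀ᶠ n in atTop,
      Nat.findGreatest (fun ℓ => Lstar.circuitSize ℓ ≤ s₁ n) (s₂ n) < s₂ n →
        ∀ (j : ℕ) (z : List Bool), j + z.length = n →
          z.length ≤ Nat.findGreatest (fun ℓ => Lstar.circuitSize ℓ ≤ s₁ n) (s₂ n) →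
            (List.replicate j true ++ z ∈ L₁ ↔ z ∈ Lstar)) :
    ∀ᶠ n in atTop, s n < L₁.circuitSize n ∨ s (s₂ n) < L₁.circuitSize (s₂ n) :=
  eventually_lt_circuitSize_or (α := fun n => Nat.findGreatest (fun ℓ => Lstar.circuitSize ℓ ≤ s₁ n) (s₂ n))
    hs₂ hii hiii hdsr (fun n => Nat.findGreatest_le (s₂ n))
    (fun _ _ hℓ h => Nat.le_findGreatest hℓ h) hdiag hL1a hL1b

end AlmostAE

end Literature.Computability.Complexity
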